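import Summits.RiemannHypothesis.RiemannHypothesis.Theorems.WeilGroundStateGroundStatesConvergeToXiPhiTail
import Summits.RiemannHypothesis.RiemannHypothesis.Theorems.WeilGroundStateGroundStatesConvergeToXiEnergyUpperTail
import Summits.RiemannHypothesis.RiemannHypothesis.Theorems.WeilGroundStateGroundStatesConvergeToXiStubPhiTranslateHarmonic
import Literature.NumberTheory.LFunctions.RiemannXiFourier
import Mathlib.Analysis.Calculus.IteratedDeriv.Lemmas
import HarnessLib

/-!
# `WeilGroundState.GroundStatesConvergeToXi` — all derivatives of Riemann's kernel are `O(e^{-|t|})`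
(crux item stmt-RiemannHypothesis-1527, route route-RiemannHypothesis-WeilGroundState; line `Sketch`,
stub `stub_phi_iteratedDeriv_envelope` (G4); `--supports`)

With `Φ(t) = 2Ψ(2t)` Riemann's kernel (`Ψ = S_p`, the theta series of `p = 2X² − 3X`,
`LagariasMontague.Psic`), the `k`-th derivative is `Φ^{(k)}(t) = 2·2^k S_{δ^k p}(2t)`
(`S_q' = S_{δ q}` termwise).  The parity of `S_{δ^k p}` alternates with `k` (`Ψ` is even, and the
derivative of an `ε`-symmetric function is `(−ε)`-symmetric), so `|S_{δ^k p}(−u)| = |S_{δ^k p}(u)|`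
and the double-exponential envelope `|S_q(2t)| ≤ C exp(|t|/2 − (π/4)e^{2|t|}) ≤ C e^{−|t|}` of
`…PhiTail` / `…StubPhiTranslateHarmonic` applies at every order: `‖Φ^{(k)}(t)‖ ≤ C_k e^{−|t|}`.

No new definitions; no named fact is used.
-/

noncomputable section

set_option linter.dupNamespace false

open scoped Topology Real
open Filter Set MeasureTheory Complex

namespace Summit.RiemannHypothesis.RiemannHypothesis.Theorems.GroundStatesConvergeToXi

open Literature.NumberTheory.LFunctions

/-! ## The closed form of `Φ^{(k)}` -/

/-- `d/dt [c · S_q(2t)] = c · 2 S_{δq}(2t)` (complex-valued). [folklore] -/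
theorem phiID_hasDerivAt_const_mul_thetaSeries (c : ℂ) (q : Polynomial ℝ) (t : ℝ) :
    HasDerivAt (fun t : ℝ => c * (LagariasMontague.thetaSeries q (2 * t) : ℂ))
      (c * 2 * (LagariasMontague.thetaSeries (LagariasMontague.thetaδ q) (2 * t) : ℂ)) t := by
  have h : HasDerivAt (fun t : ℝ => c * (LagariasMontague.thetaSeries q (2 * t) : ℂ))
      (c * ((2 : ℝ) • (LagariasMontague.thetaSeries (LagariasMontague.thetaδ q) (2 * t) : ℂ))) t :=
    (((LagariasMontague.hasDerivAt_thetaSeries q (2 * t)).ofReal_comp).scomp t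
      (hasDerivAt_const_mul (2 : ℝ))).const_mul c
  refine h.congr_deriv ?_
  rw [Complex.real_smul]
  push_cast
  ring

/-- `Φ^{(k)}(t) = 2·2^k S_{δ^k p}(2t)` with `p = 2X² − 3X`. [folklore] -/
theorem phiID_iteratedDeriv_eq (k : ℕ) :
    iteratedDeriv k (fun t : ℝ => (2 : ℂ) * LagariasMontague.Psic (2 * t)) = fun t : ℝ =>
      (2 : ℂ) * 2 ^ k * (LagariasMontague.thetaSeries
        (LagariasMontague.thetaδ^[k] LagariasMontague.psiPoly) (2 * t) : ℂ) := by
  induction k with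
  | zero =>
      rw [iteratedDeriv_zero]
      funext t
      simp [LagariasMontague.Psic, LagariasMontague.Psi]
  | succ k ih =>
      rw [iteratedDeriv_succ, ih]
      funext t
      rw [(phiID_hasDerivAt_const_mul_thetaSeries _ _ t).deriv, Function.iterate_succ_apply',
        pow_succ]
      ring

/-! ## Alternating parity of `S_{δ^k p}` -/

/-- If `S_q(−u) = ε S_q(u)` for all `u`, then `S_{δq}(−u) = −ε S_{δq}(u)`. [folklore] -/
theorem phiID_thetaSeries_δ_neg_of_neg (q : Polynomial ℝ) (ε : ℝ)
    (h : ∀ u : ℝ, LagariasMontague.thetaSeries q (-u) = ε * LagariasMontague.thetaSeries q u)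
    (u : ℝ) :
    LagariasMontague.thetaSeries (LagariasMontague.thetaδ q) (-u) =
      -ε * LagariasMontague.thetaSeries (LagariasMontague.thetaδ q) u := by
  have hfun : (fun x => LagariasMontague.thetaSeries q (-x)) =
      fun x => ε * LagariasMontague.thetaSeries q x := funext h
  have := deriv_comp_neg (f := LagariasMontague.thetaSeries q) (x := u)
  rw [hfun, deriv_const_mul _ (LagariasMontague.differentiable_thetaSeries q _),
    LagariasMontague.deriv_thetaSeries] at this
  linarith

/-- `S_{δ^k p}(−u) = (−1)^k S_{δ^k p}(u)` for `p = 2X² − 3X` (`Ψ = S_p` is even). [folklore] -/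
theorem phiID_thetaSeries_iterate_neg (k : ℕ) (u : ℝ) :
    LagariasMontague.thetaSeries (LagariasMontague.thetaδ^[k] LagariasMontague.psiPoly) (-u) =
      (-1) ^ k * LagariasMontague.thetaSeries
        (LagariasMontague.thetaδ^[k] LagariasMontague.psiPoly) u := by
  induction k generalizing u with
  | zero =>
      rw [Function.iterate_zero, id_eq, pow_zero, one_mul]
      exact LagariasMontague.Psi_neg u
  | succ k ih =>
      rw [Function.iterate_succ_apply', phiID_thetaSeries_δ_neg_of_neg _ _ ih, pow_succ]
      ring

/-- `|S_{δ^k p}(−u)| = |S_{δ^k p}(u)|` for `p = 2X² − 3X`. [folklore] -/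
theorem phiID_abs_thetaSeries_iterate_neg (k : ℕ) (u : ℝ) :
    |LagariasMontague.thetaSeries (LagariasMontague.thetaδ^[k] LagariasMontague.psiPoly) (-u)| =
      |LagariasMontague.thetaSeries (LagariasMontague.thetaδ^[k] LagariasMontague.psiPoly) u| := by
  rw [phiID_thetaSeries_iterate_neg, abs_mul, abs_pow, abs_neg, abs_one, one_pow, one_mul]

/-! ## The envelope at every order -/

/-- **Stub G4 — `phi_iteratedDeriv_envelope` (RH-free).**  Riemann's kernel is
"Schwartz-exponential": every derivative is dominated, `‖Φ^{(k)}(t)‖ ≤ C_k e^{−|t|}`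
(`Φ^{(k)}(t) = 2·2^k S_{δ^k p}(2t)` for the theta series `S_p`, `p = 2X² − 3X` =
`LagariasMontague.psiPoly`, each with the double-exponential envelope
`exists_abs_thetaSeries_two_mul_le`; parity of `S_{δ^k p}` alternates). [folklore] -/
theorem stub_phi_iteratedDeriv_envelope :
    ∀ k : ℕ, ∃ C : ℝ, ∀ t : ℝ,
      ‖iteratedDeriv k (fun t : ℝ => (2 : ℂ) * LagariasMontague.Psic (2 * t)) t‖ ≤
        C * Real.exp (-(1 * |t|)) := by
  intro k
  obtain ⟨C, hC0, hC⟩ := exists_abs_thetaSeries_two_mul_le _ (phiID_abs_thetaSeries_iterate_neg k)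
  refine ⟨2 * 2 ^ k * C, fun t => ?_⟩
  rw [phiID_iteratedDeriv_eq]
  dsimp only
  have h2 : ‖(2 : ℂ) * 2 ^ k‖ = 2 * 2 ^ k := by
    rw [norm_mul, norm_pow, Complex.norm_ofNat]
  rw [norm_mul, Complex.norm_real, Real.norm_eq_abs, h2, one_mul, mul_assoc (2 * 2 ^ k : ℝ)]
  refine mul_le_mul_of_nonneg_left ((hC t).trans ?_) (by positivity)
  exact mul_le_mul_of_nonneg_left (phiTr_envelope_le t) hC0

end Summit.RiemannHypothesis.RiemannHypothesis.Theorems.GroundStatesConvergeToXi
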